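import Mathlib
import Summits.ValiantsHypothesis.ValiantsHypothesis.Theorems.DivisionGapPerMultiplesHardStubTwoBandTableOn
import Summits.ValiantsHypothesis.ValiantsHypothesis.Theorems.DivisionGapPerMultiplesHardRelDenseCompleteClass
import Summits.ValiantsHypothesis.ValiantsHypothesis.Theorems.DivisionGapPerMultiplesHardThinPatterns
import Summits.ValiantsHypothesis.ValiantsHypothesis.Theorems.DivisionGapPerMultiplesHardPushOff
import Literature.Computability.AlgebraicComplexity.ArithCircuitProofs
import Literature.Computability.AlgebraicComplexity.PermanentIrreducible

/-!
# `DivisionGap.PerMultiplesHard` (stmt-ValiantsHypothesis-5068), line `uncharged-face-walk`: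
every frozen extension carries a hybrid probe (stub `stub_hybridProbeAssembly`)

Data.  A host `G ⊆ [n]²` (cells `(row, column)`), a cofactor `t ∈ ℝ≥0[x_ij]` which is COMPLETE on
`G` for the margins `(R; C)` (every `G`-supported table with row sums `R` and column sums `C` is an
exponent of `t`), the margins being pairwise `n`-close and of offset `> n³ + n²`; a block `A × B`
(`#A = #B = a`, cyclic order `eA : Fin a ≃ A`, `ζ := (finRotate a).extendDomain eA`); a frozen
matching `π₀` (`π₀ (B) = A`, `(π₀ j, j) ∈ G` off `B`); a dump column `bd ∈ B`; a block host
`Yb ⊆ (A × B) ∩ G` with `(ζ⁻¹ i, j) ∈ G` for `(i, j) ∈ Yb`; the sign condition `Σ_A R ≤ Σ_B C`;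
and a complement table `F` supported on `G ∩ (Aᶜ × (Bᶜ ∪ {bd}))` with row sums `R` on `Aᶜ`,
column sums `C` on `Bᶜ` and `Δ := Σ_B C - Σ_A R` at `bd`.

Claim.  Every permutation `π` frozen to `π₀` off `B` and inside `Yb` on `B` has a hybrid probe
`M ∈ supp (per_G · t)`: on the rows of `A` its cells `(i, j)` satisfy `π j = i ∨ π j = ζ i`, and its
cells in the columns of `B ∖ {bd}` lie in the rows of `A`.

Proof.  `M := μ_π + L + F`, where `L` is the two-band table of
`TwoBandTableOn.stub_twoBandTableOn` for the block margins `R' := R`,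
`C' := C - Δ · [· = bd]`, `W := n + Δ`: pairing `B` with `A` through `π₀` gives `Δ ≤ a · n`, whence
the offset `a · W + 1 ≤ n³ + n² + 1 ≤ R` (`a ≤ n`) and `Δ ≤ C bd` (so `C'` is a genuine
subtraction, the block margins are balanced and `W`-close).  The margins of `L + F` are `(R; C)`
and its support lies in `G` (the pattern cells `(π j, j)` lie in `Yb ⊆ G`, the forward cells
`(ζ⁻¹ (π j), j)` lie in `G` by the hypothesis on `Yb`, and `supp F ⊆ G`), so `L + F ∈ supp t` by
completeness; `μ_π ∈ supp per_G` since `π` lies inside `G`; supports add over `ℝ≥0`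
(`ThinPatterns.add_mem_support_mul`, `PushOff.mem_support_facePer`); the two clauses are read off
the three summands (a cell of `μ_π` is `(π j, j)`, a cell of `L` lies in a row of `A` and is a
pattern or forward cell, a cell of `F` lies off the rows of `A` and off the columns of `B ∖ {bd}`).

-- modelled on Summits/ValiantsHypothesis/ValiantsHypothesis/Theorems/DivisionGapPerMultiplesHardRelDenseCompleteClass.lean
(`probe_facePer_mul`)
-/

noncomputable section

-- `Summit.ValiantsHypothesis.ValiantsHypothesis.…` is the tree's mandated layout (Sub = Summit).
set_option linter.dupNamespace false

namespace Summit.ValiantsHypothesis.ValiantsHypothesis.Theorems.DivisionGap.PerMultiplesHard.HybridProbeAssembly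

open MvPolynomial Finset Literature.Computability.AlgebraicComplexity
open scoped NNReal BigOperators

/-! ### Margin bookkeeping -/

/-- **The gap of a frozen block is at most `a · n`.**  If `π₀ (B) = A`, `#B = a` and the margins
are `n`-close (`C j ≤ R i + n`), then `Σ_B C ≤ Σ_A R + a · n`: pair `j ∈ B` with `π₀ j ∈ A`.
[folklore] -/
theorem gap_le_mul {n a : ℕ} (A B : Finset (Fin n)) (π₀ : Equiv.Perm (Fin n)) (R C : Fin n → ℕ)
    (Δ : ℕ) (hB : B.card = a) (hπ₀ : ∀ j, j ∈ B ↔ π₀ j ∈ A)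
    (hclose : ∀ i j, R i ≤ C j + n ∧ C j ≤ R i + n)
    (hΔ : ∑ j ∈ B, C j = ∑ i ∈ A, R i + Δ) : Δ ≤ a * n := by
  have h1 : ∑ j ∈ B, C j ≤ ∑ j ∈ B, (R (π₀ j) + n) :=
    Finset.sum_le_sum fun j _ => (hclose (π₀ j) j).2
  have h2 : ∑ j ∈ B, R (π₀ j) = ∑ i ∈ A, R i := Finset.sum_equiv π₀ hπ₀ fun j _ => rfl
  rw [Finset.sum_add_distrib, h2, Finset.sum_const, smul_eq_mul, hB] at h1
  omega

/-- **Lowering one column margin.**  If `Δ ≤ C bd` there are margins `C'` agreeing with `C` off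
`bd` with `C' bd + Δ = C bd`. [folklore] -/
theorem exists_lowered_margin {n : ℕ} (C : Fin n → ℕ) (bd : Fin n) (Δ : ℕ) (h : Δ ≤ C bd) :
    ∃ C' : Fin n → ℕ, (∀ j, j ≠ bd → C' j = C j) ∧ C' bd + Δ = C bd :=
  ⟨Function.update C bd (C bd - Δ), fun _ hj => Function.update_of_ne hj _ _, by
    rw [Function.update_self]; exact Nat.sub_add_cancel h⟩

/-- **Margins of `L + F`.**  If `L` has row sums `R` on `A`, `0` off `A`, column sums `C'` on `B`,
`0` off `B` (`C'` agreeing with `C` on `B ∖ {bd}`, `C' bd + Δ = C bd`), and `F` is supported off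
the rows of `A` and off the columns of `B ∖ {bd}` with row sums `R` off `A`, column sums `C` off
`B` and `Δ` at `bd ∈ B`, then `L + F` has row sums `R` and column sums `C`. [folklore] -/
theorem margins_add {n : ℕ} (A B : Finset (Fin n)) (bd : Fin n) (R C C' : Fin n → ℕ) (Δ : ℕ)
    (L F : (Fin n × Fin n) →₀ ℕ) (hC'1 : ∀ j, j ≠ bd → C' j = C j) (hC'2 : C' bd + Δ = C bd)
    (hbd : bd ∈ B) (hLrowA : ∀ i ∈ A, ∑ j, L (i, j) = R i) (hLrowAc : ∀ i ∉ A, ∑ j, L (i, j) = 0)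
    (hLcolB : ∀ j ∈ B, ∑ i, L (i, j) = C' j) (hLcolBc : ∀ j ∉ B, ∑ i, L (i, j) = 0)
    (hFsupp : ∀ e ∈ F.support, e.1 ∉ A ∧ (e.2 ∉ B ∨ e.2 = bd))
    (hFrow : ∀ i, i ∉ A → ∑ j, F (i, j) = R i) (hFcol : ∀ j, j ∉ B → ∑ i, F (i, j) = C j)
    (hFbd : ∑ i, F (i, bd) = Δ) :
    (∀ i, ∑ j, (L + F) (i, j) = R i) ∧ (∀ j, ∑ i, (L + F) (i, j) = C j) := by
  have hF0 : ∀ i j, F (i, j) ≠ 0 → i ∉ A ∧ (j ∉ B ∨ j = bd) :=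
    fun i j h => hFsupp (i, j) (Finsupp.mem_support_iff.mpr h)
  refine ⟨fun i => ?_, fun j => ?_⟩
  · simp only [Finsupp.coe_add, Pi.add_apply, Finset.sum_add_distrib]
    by_cases hi : i ∈ A
    · -- row `i ∈ A`: `R i` from `L`, nothing from `F`
      have hF : ∑ j, F (i, j) = 0 :=
        Finset.sum_eq_zero fun j _ => by by_contra h; exact (hF0 i j h).1 hi
      rw [hLrowA i hi, hF, add_zero]
    · -- row `i ∉ A`: nothing from `L`, `R i` from `F`
      rw [hLrowAc i hi, hFrow i hi, zero_add]
  · simp only [Finsupp.coe_add, Pi.add_apply, Finset.sum_add_distrib]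
    by_cases hj : j ∈ B
    · by_cases hjbd : j = bd
      · -- the dump column: `C bd - Δ` from `L`, `Δ` from `F`
        rw [hjbd, hLcolB bd hbd, hFbd, hC'2]
      · -- column `j ∈ B ∖ {bd}`: `C j` from `L`, nothing from `F`
        have hF : ∑ i, F (i, j) = 0 := Finset.sum_eq_zero fun i _ => by
          by_contra h
          rcases (hF0 i j h).2 with h' | h'
          · exact h' hj
          · exact hjbd h'
        rw [hLcolB j hj, hC'1 j hjbd, hF, add_zero]
    · -- column `j ∉ B`: nothing from `L`, `C j` from `F`
      rw [hLcolBc j hj, hFcol j hj, zero_add]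

/-- **Support of `L + F`.**  If `π (B) = A`, `ζ` preserves `A`, `(π j, j) ∈ Yb` for `j ∈ B`,
`Yb ⊆ G` and `(ζ⁻¹ i, j) ∈ G` for `(i, j) ∈ Yb`, then a table `L` all of whose cells `(i, j)` have
`i ∈ A` and `π j = i ∨ π j = ζ i`, plus a table `F` supported in `G`, is supported in `G`: a pattern
cell is `(π j, j) ∈ Yb ⊆ G` (`j ∈ B` as `π j ∈ A`), a forward cell is `(ζ⁻¹ (π j), j)` with
`(π j, j) ∈ Yb`. [folklore] -/
theorem support_add_subset {n : ℕ} (A B : Finset (Fin n)) (G Yb : Finset (Fin n × Fin n))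
    (π ζ : Equiv.Perm (Fin n)) (L F : (Fin n × Fin n) →₀ ℕ) (hB : ∀ j, j ∈ B ↔ π j ∈ A)
    (hζ : ∀ i, ζ i ∈ A ↔ i ∈ A) (hπYb : ∀ j ∈ B, (π j, j) ∈ Yb) (hYbG : Yb ⊆ G)
    (hYbζ : ∀ e ∈ Yb, (ζ.symm e.1, e.2) ∈ G)
    (hL : ∀ e ∈ L.support, e.1 ∈ A ∧ (π e.2 = e.1 ∨ π e.2 = ζ e.1)) (hFG : F.support ⊆ G) :
    (L + F).support ⊆ G := by
  classical
  rintro ⟨r, c⟩ he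
  rcases Finset.mem_union.mp (Finsupp.support_add he) with h | h
  · obtain ⟨hr, h2 | h2⟩ := hL _ h
    · -- pattern cell `(π c, c)`, `c ∈ B`
      have hc : c ∈ B := (hB c).mpr (by rw [h2]; exact hr)
      have hG := hYbG (hπYb c hc)
      rwa [h2] at hG
    · -- forward cell `(ζ⁻¹ (π c), c)`, `c ∈ B`
      have hc : c ∈ B := (hB c).mpr (by rw [h2]; exact (hζ r).mpr hr)
      have hG := hYbζ _ (hπYb c hc)
      dsimp only at hG
      rwa [h2, Equiv.symm_apply_apply] at hG
  · exact hFG h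

/-! ### The hybrid probe -/

/-- **Every frozen-extension permutation carries a hybrid probe.**  Host `G`, cofactor `t`
complete on `G` for `n`-close margins `(R; C)` of offset `> n³ + n²`, block `A × B`
(`#A = #B = a`, cyclic order `eA`, `ζ := (finRotate a).extendDomain eA`), frozen matching `π₀`
(`π₀ (B) = A`, `(π₀ j, j) ∈ G` off `B`), dump column `bd ∈ B`, block host `Yb ⊆ (A × B) ∩ G` with
`(ζ⁻¹ i, j) ∈ G` for `(i, j) ∈ Yb`, the sign condition `Σ_A R ≤ Σ_B C`, and a complement table `F`
supported on `G ∩ (Aᶜ × (Bᶜ ∪ {bd}))` with row sums `R` on `Aᶜ`, column sums `C` on `Bᶜ` and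
`Σ_B C - Σ_A R` at `bd`.  Then every `π` frozen to `π₀` off `B` and inside `Yb` on `B` has a probe
`M ∈ supp (per_G · t)` whose cells `(i, j)` with `i ∈ A` satisfy `π j = i ∨ π j = ζ i` and whose
cells in the columns of `B ∖ {bd}` lie in the rows of `A`.  Construction: `M := μ_π + L + F` with
`L` the two-band table of `TwoBandTableOn.stub_twoBandTableOn` for the block margins `R`,
`C - (Σ_B C - Σ_A R) · [· = bd]` and width `n + (Σ_B C - Σ_A R)`. [folklore] -/
theorem stub_hybridProbeAssembly :
    ∀ (n a : ℕ) (A B : Finset (Fin n)) (G Yb : Finset (Fin n × Fin n)) (eA : Fin a ≃ {i // i ∈ A})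
      (π₀ : Equiv.Perm (Fin n)) (bd : Fin n) (t : MvPolynomial (Fin n × Fin n) ℝ≥0) (R C : Fin n → ℕ)
      (F : (Fin n × Fin n) →₀ ℕ),
      A.card = a → B.card = a → (∀ j, j ∈ B ↔ π₀ j ∈ A) → (∀ j, j ∉ B → (π₀ j, j) ∈ G) → bd ∈ B →
      Yb ⊆ A ×ˢ B → Yb ⊆ G → (∀ e ∈ Yb, ((((finRotate a).extendDomain eA).symm e.1), e.2) ∈ G) →
      (∀ m ∈ t.support, (∀ i, ∑ j, m (i, j) = R i) ∧ (∀ j, ∑ i, m (i, j) = C j)) →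
      (∀ M : (Fin n × Fin n) →₀ ℕ, M.support ⊆ G →
        (∀ i, ∑ j, M (i, j) = R i) → (∀ j, ∑ i, M (i, j) = C j) → M ∈ t.support) →
      (∀ i j, R i ≤ C j + n ∧ C j ≤ R i + n) → (∀ i, n ^ 3 + n ^ 2 + 1 ≤ R i) →
      ∑ i ∈ A, R i ≤ ∑ j ∈ B, C j →
      F.support ⊆ G → (∀ e ∈ F.support, e.1 ∉ A ∧ (e.2 ∉ B ∨ e.2 = bd)) →
      (∀ i, i ∉ A → ∑ j, F (i, j) = R i) →
      (∀ j, j ∉ B → ∑ i, F (i, j) = C j) → (∑ i, F (i, bd) = ∑ j ∈ B, C j - ∑ i ∈ A, R i) →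
      ∀ π : Equiv.Perm (Fin n), (∀ j, j ∉ B → π j = π₀ j) → (∀ j ∈ B, (π j, j) ∈ Yb) →
        ∃ M ∈ ((∑ σ ∈ (Finset.univ : Finset (Equiv.Perm (Fin n))).filter (fun σ => ∀ i, (σ i, i) ∈ G),
              monomial (permMonomial σ) (1 : ℝ≥0)) * t).support,
          (∀ e ∈ M.support, e.1 ∈ A → (π e.2 = e.1 ∨ π e.2 = ((finRotate a).extendDomain eA) e.1)) ∧
          (∀ e ∈ M.support, e.2 ∈ B → e.2 ≠ bd → e.1 ∈ A) := by
  classical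
  intro n a A B G Yb eA π₀ bd t R C F hAcard hBcard hπ₀ hπ₀G hbd hYbAB hYbG hYbζ _ hfull hclose hoff
    hsign hFG hFsupp hFrow hFcol hFbd π hπ hπYb
  -- the gap `Δ := Σ_B C - Σ_A R`
  obtain ⟨Δ, hΔ⟩ := Nat.exists_eq_add_of_le hsign
  have hFbd' : ∑ i, F (i, bd) = Δ := by rw [hFbd, hΔ, Nat.add_sub_cancel_left]
  -- `π (B) = A` and `π` lies inside `G`
  have hB : ∀ j, j ∈ B ↔ π j ∈ A := by
    intro j
    by_cases hj : j ∈ B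
    · exact iff_of_true hj (Finset.mem_product.mp (hYbAB (hπYb j hj))).1
    · rw [hπ j hj]
      exact iff_of_false hj fun h => hj ((hπ₀ j).mpr h)
  have hπG : ∀ j, (π j, j) ∈ G := by
    intro j
    by_cases hj : j ∈ B
    · exact hYbG (hπYb j hj)
    · rw [hπ j hj]
      exact hπ₀G j hj
  -- sizes: `a ≤ n`, `Δ ≤ a · n`, `Δ ≤ C bd`
  have ha : a ≤ n := by
    have h := Finset.card_le_univ A
    rwa [Fintype.card_fin, hAcard] at h
  have hΔle : Δ ≤ a * n := gap_le_mul A B π₀ R C Δ hBcard hπ₀ hclose hΔ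
  have han : a * n ≤ n * n := Nat.mul_le_mul_right n ha
  have hΔC : Δ ≤ C bd := by
    have h2 : n ≤ n ^ 3 := Nat.le_self_pow (by norm_num) n
    have h3 := hoff bd
    have h4 := (hclose bd bd).1
    nlinarith [h2, h3, h4, hΔle, han]
  -- the block margins `R' := R`, `C' := C - Δ · [· = bd]`, width `W := n + Δ`
  obtain ⟨C', hC'1, hC'2⟩ := exists_lowered_margin C bd Δ hΔC
  have hbal : ∑ i ∈ A, R i = ∑ j ∈ B, C' j := by
    have e1 := Finset.add_sum_erase B C hbd
    have e2 := Finset.add_sum_erase B C' hbd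
    have e3 : ∑ j ∈ B.erase bd, C' j = ∑ j ∈ B.erase bd, C j :=
      Finset.sum_congr rfl fun j hj => hC'1 j (Finset.ne_of_mem_erase hj)
    omega
  have hclose' : ∀ i ∈ A, ∀ j ∈ B, R i ≤ C' j + (n + Δ) ∧ C' j ≤ R i + (n + Δ) := by
    intro i _ j _
    obtain ⟨h1, h2⟩ := hclose i j
    by_cases hj : j = bd
    · rw [hj] at h1 h2 ⊢
      omega
    · rw [hC'1 j hj]
      omega
  have hoff' : ∀ i ∈ A, a * (n + Δ) + 1 ≤ R i := by
    intro i _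
    have h1 := hoff i
    have h2 : a * Δ ≤ n * (n * n) := Nat.mul_le_mul ha (hΔle.trans han)
    nlinarith [h1, h2, han]
  -- the two-band table on the block
  obtain ⟨L, hLsupp, hLrowA, hLrowAc, hLcolB, hLcolBc⟩ :=
    TwoBandTableOn.stub_twoBandTableOn n a A B eA π R C' (n + Δ) hB hbal hclose' hoff'
  -- `L + F ∈ supp t` by completeness
  obtain ⟨hmR, hmC⟩ := margins_add A B bd R C C' Δ L F hC'1 hC'2 hbd hLrowA hLrowAc hLcolB hLcolBc
    hFsupp hFrow hFcol hFbd'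
  have hmG : (L + F).support ⊆ G :=
    support_add_subset A B G Yb π _ L F hB (TwoBandTableOn.extendDomain_mem_iff A eA _) hπYb hYbG
      hYbζ hLsupp hFG
  have hm : L + F ∈ t.support := hfull _ hmG hmR hmC
  -- `M := μ_π + (L + F) ∈ supp (per_G · t)`
  refine ⟨permMonomial π + (L + F),
    ThinPatterns.add_mem_support_mul (PushOff.mem_support_facePer.2 ⟨π, hπG, rfl⟩) hm, ?_, ?_⟩
  · -- the two-band clause on the rows of `A`
    rintro ⟨r, c⟩ he hr
    rcases Finset.mem_union.mp (Finsupp.support_add he) with h | h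
    · -- a cell of `μ_π` is `(π c, c)`
      left
      have h' := Finsupp.mem_support_iff.mp h
      rw [permMonomial_apply] at h'
      by_contra hne
      exact h' (if_neg hne)
    · rcases Finset.mem_union.mp (Finsupp.support_add h) with h | h
      · exact (hLsupp _ h).2
      · exact absurd hr (hFsupp _ h).1
  · -- the columns of `B ∖ {bd}` are covered by the rows of `A`
    rintro ⟨r, c⟩ he hc hcbd
    rcases Finset.mem_union.mp (Finsupp.support_add he) with h | h
    · -- a cell of `μ_π` is `(π c, c)` with `π c ∈ A` as `c ∈ B`
      have h' := Finsupp.mem_support_iff.mp h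
      rw [permMonomial_apply] at h'
      have hπc : π c = r := by
        by_contra hne
        exact h' (if_neg hne)
      have hA : π c ∈ A := (hB c).mp hc
      rwa [hπc] at hA
    · rcases Finset.mem_union.mp (Finsupp.support_add h) with h | h
      · exact (hLsupp _ h).1
      · rcases (hFsupp _ h).2 with h2 | h2
        · exact absurd hc h2
        · exact absurd h2 hcbd

end Summit.ValiantsHypothesis.ValiantsHypothesis.Theorems.DivisionGap.PerMultiplesHard.HybridProbeAssembly

end
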